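import Literature.AlgebraicGeometry.HodgeTheory.FermatShiodaCondition
import HarnessLib

/-!
# Schoen-simple μ₆-data have an even number of index-2 points (WEIL-2 gen 31, FERMAT-G31 §3, fact-free core)

research route, not a corollary; conditional on HC_CM plus one named minimal statement.

Cell `pub-hodge-ring2-ab-*` (ALL ABELIAN VARIETIES), seat WEIL-2 gen 31, account
`run/shared/lean/pub/pub-hodge-ring2/pub-hodge-ring2-ab-weil-2/FERMAT-G31.md` §3 (THEOREM S, COROLLARY T).

Informal setting.  For a cyclic μ₆-cover of a curve the exponent data `{α_j} ⊂ ℤ/6 ∖ 0` are SCHOEN-SIMPLE when they are a sum of pairs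
`{a, −a}` ([Schoen 1988, §1]: then Thm 2.0 + Cor 3.1 make the Weil classes of the primitive Prym algebraic), and the piece is NON-SPLIT iff
the number of index-2 points (`α_j = 3`) is ODD (THEOREM L of the cell, gen 11).  The two are incompatible: a sum of pairs `{a, −a}` over
`ℤ/6` contains `3` an even number of times (`{3, −3} = {3, 3}`).  So no non-split μ₆-piece is ever Schoen-simple — the combinatorial shadow
of LEMMA R14.1 («simple ⟹ hyperbolic») — and the non-split sphere types are exactly the clients of THEOREM F's Fermat-quotient route
(files `Ring2AbelianAllFermatQuotientCharacters*`).  This file proves the parity statement for every list of pairs, and records that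
nevertheless every non-empty Hodge multiset over `ℤ/6` lies in every Shioda-closed family (the tree's `shiodaCondition_six`), i.e. the
Fermat route is available for ALL balanced μ₆ sphere data.

0 sorry, no `def`, no named fact; `HC_CM` does not occur.
-/

open Multiset
open Literature.AlgebraicGeometry.HodgeTheory.FermatCharacter

namespace Summit.HodgeConjecture.Ring2AbelianAll.FermatQuotientParity

/-- A Schoen pair `{a, −a}` over `ℤ/6` contains the index-2 exponent `3` either twice (`a = 3`) or not at all.
[locator FERMAT-G31 §3]  research route, not a corollary; conditional on HC_CM plus one named minimal statement. -/
theorem count_three_pair_even (a : ZMod 6) : Even (count (3 : ZMod 6) ({a, -a} : Multiset (ZMod 6))) := by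
  revert a; decide

/-- **Schoen-simple μ₆-data have an even number of index-2 points**: for every list of residues `l`, the sum of the pairs
`{a, −a}` (`a ∈ l`) contains `3` an even number of times.  With THEOREM L (non-split ⟺ odd number of `3`s) this is «no non-split
μ₆-piece has Schoen-simple data» (the μ₆ case of LEMMA R14.1's consequence).  [locator FERMAT-G31 §3]
research route, not a corollary; conditional on HC_CM plus one named minimal statement. -/
theorem even_count_three_sum_pairs (l : List (ZMod 6)) :
    Even (count (3 : ZMod 6) ((l.map fun a => ({a, -a} : Multiset (ZMod 6))).sum)) := by
  induction l with
  | nil => simp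
  | cons a l ih =>
    rw [List.map_cons, List.sum_cons, count_add]
    exact (count_three_pair_even a).add ih

/-- Hence a μ₆ exponent multiset with an ODD number of `3`s — every non-split sphere type of the cyclic atlas, e.g. `{1,2,2,3,4,4,4,4}` —
is not a sum of Schoen pairs.  [locator FERMAT-G31 §3]  research route, not a corollary; conditional on HC_CM plus one named minimal statement. -/
theorem not_sum_pairs_of_odd_count_three {s : Multiset (ZMod 6)} (hs : Odd (count (3 : ZMod 6) s)) (l : List (ZMod 6)) :
    (l.map fun a => ({a, -a} : Multiset (ZMod 6))).sum ≠ s := by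
  intro h
  have he := even_count_three_sum_pairs l
  rw [h] at he
  exact (Nat.not_even_iff_odd.mpr hs) he

/-- The type `[1 2² 3 4⁴]` (a non-split (3,3) sphere habitat of `NonsplitSixfolds`) has exactly one index-2 point.
[locator FERMAT-G31 §5 TABLE T]  research route, not a corollary; conditional on HC_CM plus one named minimal statement. -/
theorem count_three_type_1_2_2_3_4_4_4_4 : count (3 : ZMod 6) ({1, 2, 2, 3, 4, 4, 4, 4} : Multiset (ZMod 6)) = 1 := by
  decide

/-- … so it is not Schoen-simple (no decomposition into pairs `{a, −a}`), whatever the list of pairs.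
[locator FERMAT-G31 §5 TABLE T]  research route, not a corollary; conditional on HC_CM plus one named minimal statement. -/
theorem type_1_2_2_3_4_4_4_4_not_sum_pairs (l : List (ZMod 6)) :
    (l.map fun a => ({a, -a} : Multiset (ZMod 6))).sum ≠ ({1, 2, 2, 3, 4, 4, 4, 4} : Multiset (ZMod 6)) :=
  not_sum_pairs_of_odd_count_three (by rw [count_three_type_1_2_2_3_4_4_4_4]; exact odd_one) l

/-- **The Fermat route is available for ALL balanced μ₆ data**: every non-empty Hodge multiset over `ℤ/6` lies in every family closed
under the inductive structure of Fermat varieties — the tree's kernel-checked `(P₆)` (`shiodaCondition_six`) fed into Shioda's spine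
(`IsShiodaClosed.of_shiodaCondition`).  With `C = 𝔈₆`: every eigenline `V(α)`, `α ∈ 𝔅ⁿ₆`, is algebraic granted the printed inductive
structure — the input THEOREM F needs for every balanced μ₆ sphere type at once.  [locator FERMAT-G31 §2 LEMMA E]
research route, not a corollary; conditional on HC_CM plus one named minimal statement. -/
theorem mem_of_isShiodaClosed_of_isHodgeMultiset_six {C : Multiset (ZMod 6) → Prop} (hC : IsShiodaClosed C)
    {s : Multiset (ZMod 6)} (hs0 : s ≠ 0) (hs : IsHodgeMultiset s) : C s :=
  hC.of_shiodaCondition shiodaCondition_six s hs0 hs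

end Summit.HodgeConjecture.Ring2AbelianAll.FermatQuotientParity
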